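import Mathlib.NumberTheory.ModularForms.LevelOne.DimensionFormula
import Literature.NumberTheory.EllipticCurves.CuspFormsGamma1EisensteinDivision
import Literature.NumberTheory.EllipticCurves.KleinJIntegralQExpansion
import HarnessLib

/-!
# Sturm's congruence theorem at level one: a level-one form whose coefficients lie in a
# subring `R ⊆ ℂ` and whose first `⌊w/12⌋ + 1` coefficients lie in an ideal `P ⊆ R` has all
# its coefficients in `P`

Topic `Literature/NumberTheory/ModularForms`.  THEOREMS ONLY (no definition, no named fact); this
is the level-one step of the discharge of the named fact
`Literature.NumberTheory.ModularForms.Sturm1987_congruence_modPrime_gamma1` (`SturmCongruence.lean`),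
following M. Ram Murty, *Congruences between modular forms* (1997), §3, Prop. 6 and the proof of
Theorem 5 in the level-one case, with Mathlib's division by `Δ`
(`CuspForm.discriminantEquiv`, the mechanism of Mathlib's characteristic-zero
`ModularForm.sturm_bound_levelOne`) in place of Murty's polynomial in `j`:

* `levelOne_map_toSubring_qExpansion_eq_zero` (and its coefficient form
  `levelOne_coeff_toSubring_mem`) — for `F ∈ M_w(SL₂(ℤ))` (`w : ℕ`) whose
  `q`-expansion coefficients lie in a subring `R` of `ℂ`, and an ideal `P` of `R`: if
  `aₙ(F) ∈ P` for all `n ≤ w/12`, then `aₙ(F) ∈ P` for every `n` (Murty 1997, Thm. 5 at level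
  one, for an arbitrary ideal in place of a prime `𝔭 ⊆ 𝒪_F`).  Proof by induction on `w` in steps
  of `12`: `M_w = 0` for `w` odd or `w = 2`; otherwise `F - a₀ E₄ᵃE₆ᵇ` (`4a + 6b = w`, `E₄, E₆`
  with integral expansions and constant term `1`) is `Δ · H` with `H ∈ M_{w-12}`, the expansion
  of `Δ` is `q` times a unit of `ℤ⟦q⟧` (`qExpansion_discriminant`), so the coefficients of `H` lie
  in `R`, those of index `≤ w/12 - 1` lie in `P`, and induction applies (`H = 0` if `w < 12`).
* the algebra behind it (`PowerSeries.toSubring` lifts and reduction to `(R ⧸ P)⟦X⟧`):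
  `toSubring_map_intCast`, `toSubring_mul/add/smul`, `coeff_mul_mem`,
  `X_pow_dvd_of_X_mul_unit_mul`, `map_quotient_mk_eq_zero_iff`, `X_pow_dvd_map_quotient_mk_iff`,
  and the existence of `E₄ᵃE₆ᵇ` of any even weight `≠ 2` with integral expansion
  (`levelOne_exists_integral_form`).

## References

* [Murty1997] M. Ram Murty, *Congruences between modular forms*, in: Analytic Number Theory
  (Kyoto 1996), LMS Lecture Note Ser. 247 (1997), 309–320, §3 (Prop. 6, Thm. 5 at level one).
* [Sturm1987] J. Sturm, *On the congruence of modular forms*, LNM 1240 (1987), 275–280, Thm. 1.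
-/

noncomputable section

namespace Literature.NumberTheory.ModularForms

open scoped MatrixGroups ModularForm
open UpperHalfPlane ModularForm PowerSeries
open Literature.NumberTheory.EllipticCurves Literature.NumberTheory.EllipticCurves.ModularForms

/-! ### Power series with coefficients in a subring: reduction modulo an ideal -/

section Algebra

variable {R : Subring ℂ}

/-- An integer power series mapped to `ℂ` has coefficients in every subring `R`, and its lift to
`R⟦X⟧` is the same integer series mapped to `R`. [folklore] -/
theorem toSubring_map_intCast (Q : PowerSeries ℤ)
    (h : ∀ n, coeff n (Q.map (Int.castRingHom ℂ)) ∈ R) :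
    (Q.map (Int.castRingHom ℂ)).toSubring R h = Q.map (Int.castRingHom R) := by
  apply PowerSeries.map_injective R.subtype Subtype.val_injective
  rw [map_toSubring]
  ext n
  simp

/-- Coefficients of an integer series mapped to `ℂ` lie in any subring. [folklore] -/
theorem coeff_map_intCast_mem (Q : PowerSeries ℤ) (n : ℕ) :
    coeff n (Q.map (Int.castRingHom ℂ)) ∈ R := by
  rw [coeff_map]
  exact intCast_mem R _

/-- `toSubring` is multiplicative (the subring inclusion is injective). [folklore] -/
theorem toSubring_mul (A B : PowerSeries ℂ) (hA : ∀ n, coeff n A ∈ R) (hB : ∀ n, coeff n B ∈ R)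
    (hAB : ∀ n, coeff n (A * B) ∈ R) :
    (A * B).toSubring R hAB = A.toSubring R hA * B.toSubring R hB := by
  apply PowerSeries.map_injective R.subtype Subtype.val_injective
  rw [map_mul, map_toSubring, map_toSubring, map_toSubring]

/-- `toSubring` is additive. [folklore] -/
theorem toSubring_add (A B : PowerSeries ℂ) (hA : ∀ n, coeff n A ∈ R) (hB : ∀ n, coeff n B ∈ R)
    (hAB : ∀ n, coeff n (A + B) ∈ R) :
    (A + B).toSubring R hAB = A.toSubring R hA + B.toSubring R hB := by
  apply PowerSeries.map_injective R.subtype Subtype.val_injective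
  rw [map_add, map_toSubring, map_toSubring, map_toSubring]

/-- `toSubring` of a scalar multiple by an element of `R`. [folklore] -/
theorem toSubring_smul (A : PowerSeries ℂ) (hA : ∀ n, coeff n A ∈ R) (a : ℂ) (ha : a ∈ R)
    (haA : ∀ n, coeff n (a • A) ∈ R) :
    (a • A).toSubring R haA = C (⟨a, ha⟩ : R) * A.toSubring R hA := by
  apply PowerSeries.map_injective R.subtype Subtype.val_injective
  rw [map_mul, map_toSubring, map_toSubring, map_C, smul_eq_C_mul]
  rfl

/-- The coefficients of a product of two series with coefficients in `R` lie in `R`. [folklore] -/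
theorem coeff_mul_mem {A B : PowerSeries ℂ} (hA : ∀ n, coeff n A ∈ R) (hB : ∀ n, coeff n B ∈ R)
    (n : ℕ) : coeff n (A * B) ∈ R := by
  have : A * B = (A.toSubring R hA * B.toSubring R hB).map R.subtype := by
    rw [map_mul, map_toSubring, map_toSubring]
  rw [this, coeff_map]
  exact SetLike.coe_mem _

variable {S : Type*} [CommRing S]

/-- If `Xⁿ⁺¹ ∣ X · u · H` in `S⟦X⟧` with `u` a unit, then `Xⁿ ∣ H`. [folklore] -/
theorem X_pow_dvd_of_X_mul_unit_mul {u H : PowerSeries S} (hu : IsUnit u) {n : ℕ}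
    (h : (X : PowerSeries S) ^ (n + 1) ∣ X * u * H) : (X : PowerSeries S) ^ n ∣ H := by
  obtain ⟨v, rfl⟩ := hu
  have hvH : (X : PowerSeries S) ^ n ∣ (v : PowerSeries S) * H := by
    rw [X_pow_dvd_iff] at h ⊢
    intro m hm
    have := h (m + 1) (by omega)
    rwa [mul_assoc, coeff_succ_X_mul] at this
  have hH : H = (↑v⁻¹ : PowerSeries S) * ((v : PowerSeries S) * H) := by
    rw [← mul_assoc, Units.inv_mul, one_mul]
  rw [hH]
  exact hvH.mul_left _

end Algebra

/-! ### Level one: integral forms of every even weight `≠ 2` -/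

section LevelOne

/-- For every even `w ≠ 2` there is a level-one form of weight `w` — namely `E₄ᵃ E₆ᵇ` with
`4a + 6b = w` — whose `q`-expansion is an integer series with constant term `1`. [folklore] -/
theorem levelOne_exists_integral_form (w : ℕ) (hw : Even w) (hw2 : w ≠ 2) :
    ∃ (E : ModularForm 𝒮ℒ (w : ℤ)) (E₀ : PowerSeries ℤ), constantCoeff E₀ = 1 ∧
      E₀.map (Int.castRingHom ℂ) = qExpansion 1 E := by
  obtain ⟨P₄, hP₄, hP₄'⟩ := exists_int_map_eq_qExpansion_E₄
  obtain ⟨P₆, hP₆, hP₆'⟩ := exists_int_map_eq_qExpansion_E₆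
  -- `w = 4a + 6b`
  obtain ⟨a, b, hab⟩ : ∃ a b : ℕ, 4 * a + 6 * b = w := by
    obtain ⟨c, rfl⟩ := hw
    rcases Nat.even_or_odd c with ⟨d, rfl⟩ | ⟨d, rfl⟩
    · exact ⟨d, 0, by omega⟩
    · exact ⟨d - 1, 1, by omega⟩
  refine ⟨((E₄.pow a).mul (E₆.pow b)).mcast (by omega), P₄ ^ a * P₆ ^ b, ?_, ?_⟩
  · rw [map_mul, map_pow, map_pow, hP₄, hP₆, one_pow, one_pow, one_mul]
  · rw [ModularForm.qExpansion_mcast, ModularForm.qExpansion_mul one_pos one_mem_strictPeriods_SL,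
      ModularForm.qExpansion_pow one_pos one_mem_strictPeriods_SL,
      ModularForm.qExpansion_pow one_pos one_mem_strictPeriods_SL, map_mul, map_pow, map_pow,
      hP₄', hP₆']

/-- A level-one form of odd weight or of weight `2` is zero. [folklore] -/
theorem levelOne_eq_zero_of_odd_or_two {w : ℕ} (h : Odd w ∨ w = 2) (F : ModularForm 𝒮ℒ (w : ℤ)) :
    F = 0 := by
  rcases h with hw | rfl
  · exact ModularForm.levelOne_odd_weight_eq_zero (by exact_mod_cast hw) F
  · exact rank_zero_iff_forall_zero.mp ModularForm.levelOne_weight_two_rank_zero F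

/-- Reduction modulo `P` kills a series over `R` iff all its coefficients lie in `P`. [folklore] -/
theorem map_quotient_mk_eq_zero_iff {R : Type*} [CommRing R] (P : Ideal R) (S : PowerSeries R) :
    S.map (Ideal.Quotient.mk P) = 0 ↔ ∀ n, coeff n S ∈ P := by
  simp [PowerSeries.ext_iff, coeff_map, Ideal.Quotient.eq_zero_iff_mem]

/-- `Xᵐ` divides the reduction modulo `P` iff the coefficients of index `< m` lie in `P`.
[folklore] -/
theorem X_pow_dvd_map_quotient_mk_iff {R : Type*} [CommRing R] (P : Ideal R) (S : PowerSeries R)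
    (m : ℕ) : (X : PowerSeries (R ⧸ P)) ^ m ∣ S.map (Ideal.Quotient.mk P) ↔
      ∀ n < m, coeff n S ∈ P := by
  simp [X_pow_dvd_iff, coeff_map, Ideal.Quotient.eq_zero_iff_mem]

/-- **Sturm's congruence theorem at level one** (Murty 1997, §3: Prop. 6 and the level-one case
of Thm. 5, for an arbitrary ideal `P` of an arbitrary subring `R ⊆ ℂ` in place of a prime of the
ring of integers of a number field): if `F ∈ M_w(SL₂(ℤ))` has `q`-expansion coefficients in `R`
and `aₙ(F) ∈ P` for all `n ≤ w/12` (i.e. `X^{⌊w/12⌋+1}` divides the reduction of the expansion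
modulo `P`), then `aₙ(F) ∈ P` for all `n` (the reduction vanishes).  Induction on `w` by
division by `Δ`, whose expansion is `q` times a unit of `ℤ⟦q⟧`. [cite: Murty1997, §3 Prop. 6 and Thm. 5 (level one)] -/
theorem levelOne_map_toSubring_qExpansion_eq_zero (R : Subring ℂ) (P : Ideal R) (w : ℕ)
    (F : ModularForm 𝒮ℒ (w : ℤ)) (hR : ∀ n, coeff n (qExpansion 1 F) ∈ R)
    (hP : (X : PowerSeries (R ⧸ P)) ^ (w / 12 + 1) ∣
      ((qExpansion 1 F).toSubring R hR).map (Ideal.Quotient.mk P)) :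
    ((qExpansion 1 F).toSubring R hR).map (Ideal.Quotient.mk P) = 0 := by
  induction w using Nat.strong_induction_on with | _ w ih => ?_
  -- the trivial weights: `w` odd or `w = 2`
  by_cases hw : Odd w ∨ w = 2
  · have hF : F = 0 := levelOne_eq_zero_of_odd_or_two hw F
    have h0 : (qExpansion 1 F).toSubring R hR = 0 := by
      apply PowerSeries.map_injective R.subtype Subtype.val_injective
      rw [map_toSubring, map_zero, hF, ModularForm.coe_zero, qExpansion_zero]
    rw [h0, map_zero]
  push Not at hw
  have hw' : Even w := Nat.not_odd_iff_even.mp hw.1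
  obtain ⟨E, E₀, hE₀, hE⟩ := levelOne_exists_integral_form w hw' hw.2
  -- the discriminant: `qExpansion 1 Δ = X · U` with `U` a unit of `ℤ⟦X⟧`
  set U : PowerSeries ℤ := formalDeltaUnit with hU
  have hUunit : IsUnit U := isUnit_iff_constantCoeff.mpr (by rw [hU, constantCoeff_formalDeltaUnit]; exact isUnit_one)
  obtain ⟨u, hu⟩ := hUunit
  set U' : PowerSeries ℤ := ↑u⁻¹ with hU'
  have hUU' : U' * U = 1 := by rw [hU', ← hu, Units.inv_mul]
  have hΔ : qExpansion 1 ModularForm.discriminant = (X * U).map (Int.castRingHom ℂ) :=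
    qExpansion_discriminant
  -- the constant term `a₀ ∈ P`
  have ha₀R : coeff 0 (qExpansion 1 F) ∈ R := hR 0
  have ha₀P : (⟨coeff 0 (qExpansion 1 F), ha₀R⟩ : R) ∈ P := by
    have h := (X_pow_dvd_map_quotient_mk_iff P _ _).mp hP 0 (Nat.succ_pos _)
    convert h using 1
    apply Subtype.ext
    simp
  -- `G = F - a₀ E` has vanishing constant term, so `G = Δ H`
  set a₀ : ℂ := coeff 0 (qExpansion 1 F) with ha₀
  set G : ModularForm 𝒮ℒ (w : ℤ) := F - a₀ • E with hG
  have hGexp : qExpansion 1 G = qExpansion 1 F - a₀ • qExpansion 1 E := by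
    rw [hG, ModularForm.coe_sub, ModularForm.qExpansion_sub one_pos one_mem_strictPeriods_SL,
      ModularForm.IsGLPos.coe_smul, ModularForm.qExpansion_smul one_pos one_mem_strictPeriods_SL]
  have hE0 : coeff 0 (qExpansion 1 E) = 1 := by
    rw [← hE, coeff_map, coeff_zero_eq_constantCoeff_apply, hE₀, map_one]
  have hG0 : coeff 0 (qExpansion 1 G) = 0 := by
    rw [hGexp, map_sub, coeff_smul, hE0, smul_eq_mul, mul_one, sub_self]
  set H : ModularForm 𝒮ℒ ((w : ℤ) - 12) :=
    CuspForm.discriminantEquiv (ModularForm.toCuspForm G hG0) with hH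
  have hGΔ : qExpansion 1 G = qExpansion 1 ModularForm.discriminant * qExpansion 1 H :=
    ModularForm.qExpansion_eq_qExpansion_discriminant_mul G hG0
  -- `X · qExp H = U' · qExp G`, so the coefficients of `H` lie in `R`
  have hXH : X * qExpansion 1 H = U'.map (Int.castRingHom ℂ) * qExpansion 1 G := by
    rw [hGΔ, hΔ, ← mul_assoc, ← map_mul, ← mul_assoc, mul_comm U' X, mul_assoc X, hUU', mul_one,
      map_X]
  have hRE : ∀ n, coeff n (qExpansion 1 E) ∈ R := fun n ↦ hE ▸ coeff_map_intCast_mem E₀ n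
  have hRG : ∀ n, coeff n (qExpansion 1 G) ∈ R := fun n ↦ by
    rw [hGexp, map_sub, coeff_smul, smul_eq_mul]
    exact sub_mem (hR n) (mul_mem ha₀R (hRE n))
  have hRH : ∀ n, coeff n (qExpansion 1 H) ∈ R := fun n ↦ by
    have h := congrArg (coeff (n + 1)) hXH
    rw [coeff_succ_X_mul] at h
    rw [h]
    exact coeff_mul_mem (coeff_map_intCast_mem U') hRG (n + 1)
  -- the identities in `R⟦X⟧` and modulo `P`
  set π := Ideal.Quotient.mk P with hπ
  have hUℂ : (U.map (Int.castRingHom R)).map R.subtype = U.map (Int.castRingHom ℂ) := by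
    ext n
    simp
  have hSG : (qExpansion 1 G).toSubring R hRG =
      X * U.map (Int.castRingHom R) * (qExpansion 1 H).toSubring R hRH := by
    apply PowerSeries.map_injective R.subtype Subtype.val_injective
    simp only [map_mul, map_toSubring, map_X, hUℂ]
    rw [hGΔ, hΔ, map_mul, map_X]
  have hSF : (qExpansion 1 F).toSubring R hR =
      (qExpansion 1 G).toSubring R hRG + C (⟨a₀, ha₀R⟩ : R) * E₀.map (Int.castRingHom R) := by
    apply PowerSeries.map_injective R.subtype Subtype.val_injective
    simp only [map_add, map_mul, map_toSubring, map_C, hGexp]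
    rw [smul_eq_C_mul, show (E₀.map (Int.castRingHom R)).map R.subtype = qExpansion 1 E by
      rw [← hE]; ext n; simp]
    simp [sub_add_cancel]
  have hUbar : IsUnit ((U.map (Int.castRingHom R)).map π) := by
    rw [← hu]
    exact ((u.map (PowerSeries.map (Int.castRingHom R)).toMonoidHom).map
      (PowerSeries.map π).toMonoidHom).isUnit
  have hFbar : ((qExpansion 1 F).toSubring R hR).map π =
      X * (U.map (Int.castRingHom R)).map π * ((qExpansion 1 H).toSubring R hRH).map π := by
    rw [hSF, map_add, map_mul, map_C, Ideal.Quotient.eq_zero_iff_mem.mpr ha₀P, map_zero,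
      zero_mul, add_zero, hSG, map_mul, map_mul, map_X]
  -- `X^{w/12} ∣ H̄`
  have hHdvd : (X : PowerSeries (R ⧸ P)) ^ (w / 12) ∣
      ((qExpansion 1 H).toSubring R hRH).map π :=
    X_pow_dvd_of_X_mul_unit_mul hUbar (hFbar ▸ hP)
  -- conclude: `H̄ = 0`
  suffices hH0 : ((qExpansion 1 H).toSubring R hRH).map π = 0 by
    rw [hFbar, hH0, mul_zero]
  rcases lt_or_ge w 12 with hw12 | hw12
  · -- negative weight: `H = 0`
    have hH0 : H = 0 := rank_zero_iff_forall_zero.mp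
      (ModularForm.levelOne_neg_weight_rank_zero (by omega)) H
    have : (qExpansion 1 H).toSubring R hRH = 0 := by
      apply PowerSeries.map_injective R.subtype Subtype.val_injective
      rw [map_toSubring, map_zero, hH0, ModularForm.coe_zero, qExpansion_zero]
    rw [this, map_zero]
  · -- weight `w - 12`: induction
    set H' : ModularForm 𝒮ℒ ((w - 12 : ℕ) : ℤ) := H.mcast (by omega) with hH'
    have hexp : qExpansion 1 H' = qExpansion 1 H := rfl
    have hRH' : ∀ n, coeff n (qExpansion 1 H') ∈ R := hRH
    have key := ih (w - 12) (by omega) H' hRH' (by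
      rw [show (w - 12) / 12 + 1 = w / 12 by omega]
      exact hHdvd)
    exact key

/-- Coefficient form of `levelOne_map_toSubring_qExpansion_eq_zero`: with `R ⊆ ℂ` a subring and
`P ⊆ R` an ideal, a level-one form of weight `w` with coefficients in `R` whose coefficients of
index `≤ w/12` lie in `P` has all its coefficients in `P`. [cite: Murty1997, §3 Thm. 5 (level one)] -/
theorem levelOne_coeff_toSubring_mem (R : Subring ℂ) (P : Ideal R) (w : ℕ)
    (F : ModularForm 𝒮ℒ (w : ℤ)) (hR : ∀ n, coeff n (qExpansion 1 F) ∈ R)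
    (hP : ∀ n ≤ w / 12, coeff n ((qExpansion 1 F).toSubring R hR) ∈ P) (n : ℕ) :
    coeff n ((qExpansion 1 F).toSubring R hR) ∈ P :=
  (map_quotient_mk_eq_zero_iff P _).mp (levelOne_map_toSubring_qExpansion_eq_zero R P w F hR
    ((X_pow_dvd_map_quotient_mk_iff P _ _).mpr fun n hn ↦ hP n (Nat.lt_succ_iff.mp hn))) n

end LevelOne

end Literature.NumberTheory.ModularForms

end
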